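import Summits.Schanuel.Schanuel.Theorems.RootDecomp1DFlagSplit
import Literature.NumberTheory.Transcendental.BakerLogarithmsConclusion
import Literature.NumberTheory.Transcendental.LindemannWeierstrassProofs
import Literature.NumberTheory.Transcendental.PeriodsWave0

/-!
# RootDecomp1J — decided cells of the period flag `𝓛 ≤ 𝓑 ≤ 𝓛⋆` (lens-3 g21, node v11 §6)

Port (`--supports stmt-Schanuel-24885`) of the KERNEL-CERTIFIED CELLS of §6 of the lens-3 node file
`HOME/decomp-schanuel-lens-3/v11/PeriodFlagSplit.lean` that the docstrings of the items of
route-Schanuel-RootDecomp1J (and of its parent route-Schanuel-RootDecomp1D) cite by name: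

* §1 BAKER FACE — `not_mem_bakerPeriods_of_isAlgebraic` : `ℚ̄ ∩ 𝓑 = 0` (no nonzero algebraic number is a
  Baker period; from the tree's `baker_holds`), whence `linearIndependent_mkQ_bakerPeriods_of_isAlgebraic`
  (a `ℚ`-free algebraic tuple is free modulo `𝓑`) and the rank-1 face of A = `SchanuelAtBakerPeriods`
  (stmt-Schanuel-24885), `schanuelOn_bakerPeriods_rank_one`;
* §2 LINDEMANN–WEIERSTRASS FACES — `schanuelOn_algebraics` : Schanuel's count on `span_ℚ ℚ̄` (all ranks,
  = `algebraicIndependent_exp_holds`), and its reading as the `(∅; algebraic z)`-cells of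
  P3 = `InhomBakerOverBakerFields` (stmt-Schanuel-26537), `inhomBakerOverBakerFields_cell_algebraic`
  (hypotheses certified: `algebraic_mem_inhomBaker`, `linearIndependent_mkQ_bakerPeriods_of_isAlgebraic`);
* §3 NESTERENKO CELLS (modulo the tree's named fact `Literature.NumberTheory.Transcendental.nesterenko`,
  PROVED in the tree as `nesterenko_holds` (`PeriodsWave0NesterenkoProofs.lean`); kept as a hypothesis
  `hN` only because that module tower has no hub olean — discharge = `… nesterenko_holds`):
  `transcendental_exp_pi`, `pi_free_mod_logs`, the A-cell `schanuelAtBakerPeriods_cell_ipi_pi`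
  (`trdeg ℚ(iπ, π, e^{iπ}, e^π) ≥ 2`, a rank-2 instance of stmt-Schanuel-24885 over the Baker periods
  `iπ, π`) and the RELATIVE cell `bakerPeriodsOverLogFields_cell_pi` of the 1D child
  `BakerPeriodsOverLogFields` (stmt-Schanuel-26558): `trdeg_{ℚ(iπ)} ℚ(iπ)(π, e^π) ≥ 1`, the only proved
  cell of a relative flag piece over a TRANSCENDENTAL base.

The flag spaces `𝓛 = span_ℚ{l : e^l ∈ ℚ̄}`, `𝓑 = span_ℚ{β·l}`, `𝓛⋆ = span_ℚ(ℚ̄ ∪ {β·l})` are written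
out verbatim as in the route file (this file defines nothing). Tools from the tree:
`RootDecomp1DFlagSplit.{trdeg_adjoin_le_cardinalMk, trdeg_gens_lt_aleph0, rel_iff_add}`,
`isAlgebraic_exp_of_mem_span` re-derived (= `Literature.NumberTheory.Transcendental.isAlgebraic_exp_of_mem_span`
of `SchanuelSectorSplit.lean`, whose olean is outside today's farm snapshot),
`Literature.Barriers.Schanuel.trdeg_adjoin_union_eq_of_isAlgebraic`. 0 sorry.
[cite: Baker1975, Ch. 2 Thm 2.1] [cite: Waldschmidt2000, §1.4]
[cite: NesterenkoPhilippon2001, Ch. 3 Cor. 1.2] [cite: Kirby2010, §3]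
-/

noncomputable section

open Complex IntermediateField

namespace Summit.Schanuel.Schanuel.Theorems.RootDecomp1JFlagCells

open Summit.Schanuel.Schanuel.Theorems.RootDecomp1DFlagSplit (trdeg_adjoin_le_cardinalMk
  trdeg_gens_lt_aleph0 rel_iff_add)
open Literature.NumberTheory.Transcendental (nesterenko baker_holds algebraicIndependent_exp_holds)

/-! ### §0 Folklore tools -/
/-- Monotonicity of `trdeg` along an inclusion of intermediate fields. [folklore] -/
private theorem trdeg_mono {F E : Type*} [Field F] [Field E] [Algebra F E]
    {L L' : IntermediateField F E} (h : L ≤ L') : Algebra.trdeg F L ≤ Algebra.trdeg F L' :=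
  trdeg_le_of_injective (IntermediateField.inclusion h) (IntermediateField.inclusion_injective h)

/-- `I` is algebraic (`I² + 1 = 0`); private — tree twin `RigidCore.CalibrationB.isAlgebraic_I` (gate dedup). [folklore] -/
private theorem isAlgebraic_I : IsAlgebraic ℚ I := by
  refine ⟨Polynomial.X ^ 2 + Polynomial.C 1, ?_, ?_⟩
  · exact (Polynomial.monic_X_pow_add_C (1 : ℚ) (by norm_num)).ne_zero
  · simp [Complex.I_sq]

/-- If `z` lies in the `ℚ`-span of `𝓛 = {l : e^l ∈ ℚ̄}` then `e^z ∈ ℚ̄`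
(= `Literature.NumberTheory.Transcendental.isAlgebraic_exp_of_mem_span`, re-derived as a PRIVATE copy: the twin's olean is outside today's farm snapshot). [folklore] -/
private theorem isAlgebraic_exp_of_mem_span {z : ℂ}
    (hz : z ∈ Submodule.span ℚ {z : ℂ | IsAlgebraic ℚ (Complex.exp z)}) :
    IsAlgebraic ℚ (Complex.exp z) := by
  induction hz using Submodule.span_induction with
  | mem x hx => exact hx
  | zero => rw [Complex.exp_zero]; exact isAlgebraic_one
  | add a b _ _ ha hb => rw [Complex.exp_add]; exact ha.mul hb
  | smul q a _ ha =>
    have hpow : Complex.exp (q • a) ^ q.den = Complex.exp a ^ q.num := by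
      rw [← Complex.exp_nat_mul, ← Complex.exp_int_mul, Rat.smul_def, ← mul_assoc]
      congr 2
      have h := Rat.den_mul_eq_num q
      exact_mod_cast congrArg (Rat.cast : ℚ → ℂ) h
    refine IsAlgebraic.of_pow q.den_pos ?_
    rw [hpow]
    cases q.num with
    | ofNat k => rw [Int.ofNat_eq_natCast, zpow_natCast]; exact ha.pow k
    | negSucc k => rw [zpow_negSucc]; exact (ha.pow (k + 1)).inv

/-- A `ℚ`-combination of algebraic numbers is algebraic. [folklore] -/
theorem isAlgebraic_of_mem_span_algebraic {a : ℂ}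
    (ha : a ∈ Submodule.span ℚ {z : ℂ | IsAlgebraic ℚ z}) : IsAlgebraic ℚ a := by
  induction ha using Submodule.span_induction with
  | mem x hx => exact hx
  | zero => exact isAlgebraic_zero
  | add a b _ _ ha hb => exact ha.add hb
  | smul q a _ ha =>
    rw [Rat.smul_def]
    exact (isAlgebraic_algebraMap q).mul ha

/-- The `(∅; z)`-face of a relative sector: an ABSOLUTE count `trdeg_ℚ ℚ(z, e^z) ≥ m` is the relative
count over the base field `ℚ(∅) = ℚ` (tower law, `rel_iff_add`). [folklore] -/
theorem relOn_face_empty_of_abs {m : ℕ} (y : Fin 0 → ℂ) (z : Fin m → ℂ)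
    (habs : (m : Cardinal) ≤ Algebra.trdeg ℚ ↥(adjoin ℚ (Set.range z ∪ Set.range (cexp ∘ z)))) :
    (m : Cardinal) ≤ Algebra.trdeg ↥(adjoin ℚ (Set.range y ∪ Set.range (cexp ∘ y)))
      ↥(adjoin ↥(adjoin ℚ (Set.range y ∪ Set.range (cexp ∘ y)))
        (Set.range z ∪ Set.range (cexp ∘ z))) := by
  have hfin := trdeg_gens_lt_aleph0 y
  refine (rel_iff_add _ _ hfin m).2 ?_
  have hG : Set.range y ∪ Set.range (cexp ∘ y) = ∅ := by simp [Set.range_eq_empty]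
  have hbase : Algebra.trdeg ℚ ↥(adjoin ℚ (Set.range y ∪ Set.range (cexp ∘ y))) = 0 := by
    apply nonpos_iff_eq_zero.mp
    refine (trdeg_adjoin_le_cardinalMk _).trans ?_
    rw [hG]; simp
  rw [hbase, zero_add]
  have hsub : Set.range z ∪ Set.range (cexp ∘ z) ⊆
      (Set.range y ∪ Set.range (cexp ∘ y)) ∪ (Set.range z ∪ Set.range (cexp ∘ z)) :=
    fun t ht => Or.inr ht
  exact habs.trans (trdeg_mono (adjoin.mono _ _ _ hsub))

/-! ### §1 The Baker face: `ℚ̄ ∩ 𝓑 = 0` -/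
open Submodule in
/-- `ℚ̄ ∩ 𝓑 = 0` (Baker's theorem, in the tree as `baker_holds`): no nonzero algebraic number is a
Baker period. Certifies that A = `SchanuelAtBakerPeriods` is BLIND at `(1, iπ)`, `(1, e)`, `(√2, log 2)`
and that a nonzero Baker period is transcendental. [cite: Baker1975, Ch. 2 Thm 2.1] -/
theorem not_mem_bakerPeriods_of_isAlgebraic {a : ℂ} (ha : IsAlgebraic ℚ a) (ha0 : a ≠ 0) :
    a ∉ Submodule.span ℚ
      {z : ℂ | ∃ β l : ℂ, IsAlgebraic ℚ β ∧ IsAlgebraic ℚ (Complex.exp l) ∧ z = β * l} := by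
  classical
  intro haG
  obtain ⟨T, hTG, haT⟩ := mem_span_finite_of_mem_span haG
  have hrep : ∀ t : ↥T, ∃ β l : ℂ, IsAlgebraic ℚ β ∧ IsAlgebraic ℚ (Complex.exp l) ∧
      (t : ℂ) = β * l := fun t => hTG t.2
  choose β l hβ hl hgl using hrep
  let g : ↥T → ℂ := fun t => (t : ℂ)
  have ha_span : a ∈ span ℚ (Set.range g) := by
    have hsub : (↑T : Set ℂ) ⊆ Set.range g := fun x hx => ⟨⟨x, hx⟩, rfl⟩
    exact span_mono hsub haT
  obtain ⟨c, hc⟩ := (Submodule.mem_span_range_iff_exists_fun ℚ).1 ha_span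
  set W : Submodule ℚ ℂ := span ℚ (Set.range l) with hW
  haveI : FiniteDimensional ℚ W := FiniteDimensional.span_of_finite ℚ (Set.finite_range l)
  let bW := Module.finBasis ℚ W
  let u : Fin (Module.finrank ℚ W) → ℂ := fun i => (bW i : ℂ)
  have hu_W : ∀ i, u i ∈ W := fun i => (bW i).2
  have hu_li : LinearIndependent ℚ u := bW.linearIndependent.map' W.subtype W.ker_subtype
  have hspan_u : span ℚ (Set.range u) = W := by
    apply le_antisymm
    · exact span_le.mpr (Set.range_subset_iff.mpr hu_W)
    · intro x hx
      have hb := bW.mem_span (⟨x, hx⟩ : W)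
      have hmap := Submodule.mem_map_of_mem (f := W.subtype) hb
      rw [Submodule.map_span, ← Set.range_comp] at hmap
      exact hmap
  have hu_alg : ∀ i, IsAlgebraic ℚ (Complex.exp (u i)) := by
    intro i
    have hle : W ≤ span ℚ {z : ℂ | IsAlgebraic ℚ (Complex.exp z)} :=
      span_mono (Set.range_subset_iff.mpr fun t => hl t)
    exact isAlgebraic_exp_of_mem_span (hle (hu_W i))
  set K : IntermediateField ℚ ℂ := algebraicClosure ℚ ℂ with hK
  have hBaker := baker_holds u hu_alg hu_li
  have h1 : (1 : ℂ) ∉ span K (Set.range u) := by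
    have h := (linearIndependent_option.1 hBaker).2
    simpa [Function.comp_def] using h
  have hsmul : ∀ (k : K) (x : ℂ), k • x = (k : ℂ) * x := fun k x => rfl
  have haK : a ∈ span K (Set.range u) := by
    rw [← hc]
    refine sum_mem fun t _ => ?_
    have hlt : l t ∈ span K (Set.range u) := by
      have hltW : l t ∈ span ℚ (Set.range u) := by rw [hspan_u]; exact subset_span ⟨t, rfl⟩
      exact span_le_restrictScalars ℚ K (Set.range u) hltW
    have hcoef : (c t : ℂ) * β t ∈ K :=
      mem_algebraicClosure_iff.2 ((isAlgebraic_algebraMap (c t)).mul (hβ t))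
    have hmem := (span K (Set.range u)).smul_mem (⟨(c t : ℂ) * β t, hcoef⟩ : K) hlt
    have heq : c t • g t = (⟨(c t : ℂ) * β t, hcoef⟩ : K) • l t := by
      rw [hsmul, Rat.smul_def, mul_assoc, ← hgl t]
    rw [heq]
    exact hmem
  have haKmem : a ∈ K := mem_algebraicClosure_iff.2 ha
  have hone := (span K (Set.range u)).smul_mem ((⟨a, haKmem⟩ : K)⁻¹) haK
  rw [hsmul, IntermediateField.coe_inv, inv_mul_cancel₀ ha0] at hone
  exact h1 hone

/-- A `ℚ`-linearly independent tuple of ALGEBRAIC numbers is free modulo `𝓑` (a vanishing combination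
modulo `𝓑` is an algebraic Baker period, hence `0` by `not_mem_bakerPeriods_of_isAlgebraic`): the freeness
hypothesis of P3 = `InhomBakerOverBakerFields` holds on its `(∅; algebraic z)`-cells. -/
theorem linearIndependent_mkQ_bakerPeriods_of_isAlgebraic {m : ℕ} (z : Fin m → ℂ)
    (hz : ∀ j, IsAlgebraic ℚ (z j)) (hli : LinearIndependent ℚ z) :
    LinearIndependent ℚ ((Submodule.span ℚ
      {z : ℂ | ∃ β l : ℂ, IsAlgebraic ℚ β ∧ IsAlgebraic ℚ (Complex.exp l) ∧ z = β * l}).mkQ ∘ z) := by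
  refine Fintype.linearIndependent_iff.mpr fun c hc => ?_
  have h0 : (Submodule.span ℚ
      {z : ℂ | ∃ β l : ℂ, IsAlgebraic ℚ β ∧ IsAlgebraic ℚ (Complex.exp l) ∧ z = β * l}).mkQ
        (∑ j, c j • z j) = 0 := by
    simpa [map_sum, map_smul] using hc
  have hmem : ∑ j, c j • z j ∈ Submodule.span ℚ
      {z : ℂ | ∃ β l : ℂ, IsAlgebraic ℚ β ∧ IsAlgebraic ℚ (Complex.exp l) ∧ z = β * l} :=
    (Submodule.Quotient.mk_eq_zero _).mp h0
  have halg : IsAlgebraic ℚ (∑ j, c j • z j) :=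
    isAlgebraic_of_mem_span_algebraic
      (Submodule.sum_mem _ fun j _ => Submodule.smul_mem _ _ (Submodule.subset_span (hz j)))
  by_cases hsum : ∑ j, c j • z j = 0
  · exact Fintype.linearIndependent_iff.mp hli c hsum
  · exact absurd hmem (not_mem_bakerPeriods_of_isAlgebraic halg hsum)

/-- CELL (A = `SchanuelAtBakerPeriods`, stmt-Schanuel-24885, rank `k = 1`; from Baker): a nonzero Baker
period `w` has `trdeg ℚ(w, e^w) ≥ 1` — literally the `k = 1` instance of the item. -/
theorem schanuelOn_bakerPeriods_rank_one (y : Fin 1 → ℂ)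
    (hy : ∀ i, y i ∈ Submodule.span ℚ
      {z : ℂ | ∃ β l : ℂ, IsAlgebraic ℚ β ∧ IsAlgebraic ℚ (Complex.exp l) ∧ z = β * l})
    (hli : LinearIndependent ℚ y) :
    ((1 : ℕ) : Cardinal) ≤ Algebra.trdeg ℚ ↥(adjoin ℚ (Set.range y ∪ Set.range (cexp ∘ y))) := by
  have hy0 : y 0 ≠ 0 := by
    have h := linearIndependent_unique_iff.mp hli
    exact h
  have htr : Transcendental ℚ (y 0) := fun halg =>
    not_mem_bakerPeriods_of_isAlgebraic halg hy0 (hy 0)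
  set K := adjoin ℚ (Set.range y ∪ Set.range (cexp ∘ y)) with hK
  let x : Fin 1 → K := fun i => ⟨y i, subset_adjoin ℚ _ (Or.inl ⟨i, rfl⟩)⟩
  have hyAI : AlgebraicIndependent ℚ y := algebraicIndependent_unique_type_iff.mpr htr
  have hx : AlgebraicIndependent ℚ x := AlgebraicIndependent.of_comp K.val hyAI
  simpa using hx.cardinalMk_le_trdeg

/-! ### §2 The Lindemann–Weierstrass faces -/
/-- CELL FAMILY (all ranks; = Lindemann–Weierstrass `algebraicIndependent_exp_holds`): Schanuel's count
holds on the `ℚ`-subspace `span_ℚ ℚ̄` of algebraic numbers — `S|ℚ̄`. [cite: Waldschmidt2000, §1.4] -/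
theorem schanuelOn_algebraics (k : ℕ) (y : Fin k → ℂ)
    (hy : ∀ i, y i ∈ Submodule.span ℚ {z : ℂ | IsAlgebraic ℚ z}) (hli : LinearIndependent ℚ y) :
    (k : Cardinal) ≤ Algebra.trdeg ℚ ↥(adjoin ℚ (Set.range y ∪ Set.range (cexp ∘ y))) := by
  have halg : ∀ i, IsAlgebraic ℚ (y i) := fun i => isAlgebraic_of_mem_span_algebraic (hy i)
  have hLW : AlgebraicIndependent ℚ fun i => cexp (y i) :=
    algebraicIndependent_exp_holds y halg hli
  set K := adjoin ℚ (Set.range y ∪ Set.range (cexp ∘ y)) with hK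
  let x : Fin k → K := fun i => ⟨cexp (y i), subset_adjoin ℚ _ (Or.inr ⟨i, rfl⟩)⟩
  have hx : AlgebraicIndependent ℚ x := AlgebraicIndependent.of_comp K.val hLW
  simpa using hx.cardinalMk_le_trdeg

/-- Algebraic numbers lie in `𝓛⋆ = span_ℚ(ℚ̄ ∪ {β·l})` (the upper space of P3). -/
theorem algebraic_mem_inhomBaker {a : ℂ} (ha : IsAlgebraic ℚ a) :
    a ∈ Submodule.span ℚ ({z : ℂ | IsAlgebraic ℚ z} ∪
      {z : ℂ | ∃ β l : ℂ, IsAlgebraic ℚ β ∧ IsAlgebraic ℚ (Complex.exp l) ∧ z = β * l}) :=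
  Submodule.subset_span (Or.inl ha)

/-- CELLS (P3 = `InhomBakerOverBakerFields`, stmt-Schanuel-26537, base `y = ∅`, `z` ALGEBRAIC and
`ℚ`-free, all ranks `m`): the item's conclusion `trdeg_{ℚ(∅)} ℚ(∅)(z, e^z) ≥ m` — Lindemann–Weierstrass
read relatively over the trivial base. Its hypotheses hold by `algebraic_mem_inhomBaker` and
`linearIndependent_mkQ_bakerPeriods_of_isAlgebraic`. (The full `y = ∅` face, `z ⊂ 𝓛⋆` free mod `𝓑`,
is NOT decided: `z = (1 + iπ, √2(1 + iπ))` asks for `trdeg ℚ(π, e, e^{√2(1+iπ)}) ≥ 2`.) -/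
theorem inhomBakerOverBakerFields_cell_algebraic {m : ℕ} (y : Fin 0 → ℂ) (z : Fin m → ℂ)
    (hz : ∀ j, IsAlgebraic ℚ (z j)) (hli : LinearIndependent ℚ z) :
    (m : Cardinal) ≤ Algebra.trdeg ↥(adjoin ℚ (Set.range y ∪ Set.range (cexp ∘ y)))
      ↥(adjoin ↥(adjoin ℚ (Set.range y ∪ Set.range (cexp ∘ y)))
        (Set.range z ∪ Set.range (cexp ∘ z))) :=
  relOn_face_empty_of_abs y z
    (schanuelOn_algebraics m z (fun j => Submodule.subset_span (hz j)) hli)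

/-! ### §3 The Nesterenko cells (modulo the tree fact `nesterenko`, discharged by `nesterenko_holds`) -/

/-- `π, e^π` are algebraically independent over `ℚ` (as complex numbers), from Nesterenko's theorem —
the named fact `Literature.NumberTheory.Transcendental.nesterenko` (`π, e^π, Γ(1/4)`), PROVED in the
tree (`nesterenko_holds`, `PeriodsWave0NesterenkoProofs.lean`); = `RootDecomp1ArgumentCells.
algebraicIndependent_pi_exp_pi` and `RootDecomp1EEngineType.algebraicIndependent_pi_exp_pi`; PRIVATE copy here to keep this file's imports inside the 1D/1J cone (gate dedup).
[cite: NesterenkoPhilippon2001, Ch. 3 Cor. 1.2] -/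
private theorem algebraicIndependent_pi_exp_pi (hN : nesterenko) :
    AlgebraicIndependent ℚ ![(Real.pi : ℂ), cexp (Real.pi : ℂ)] := by
  have hC : AlgebraicIndependent ℚ
      ((algebraMap ℝ ℂ).toRatAlgHom ∘ ![Real.pi, Real.exp Real.pi, Real.Gamma (1 / 4)]) :=
    hN.map' (f := (algebraMap ℝ ℂ).toRatAlgHom) (by
      intro a b h
      simpa [RingHom.toRatAlgHom_apply] using h)
  have h := hC.comp ![0, 1] (by decide)
  convert h using 1
  funext i
  fin_cases i <;> simp [RingHom.toRatAlgHom_apply, Complex.ofReal_exp]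

/-- `e^π` is transcendental (Nesterenko; Gel'fond 1934 already). -/
theorem transcendental_exp_pi (hN : nesterenko) : Transcendental ℚ (cexp (Real.pi : ℂ)) := by
  have hR : Transcendental ℚ (Real.exp Real.pi) := hN.transcendental 1
  intro halg
  apply hR
  rw [← Complex.ofReal_exp] at halg
  exact (isAlgebraic_algebraMap_iff (R := ℚ) (A := ℂ)
    (RingHom.injective (algebraMap ℝ ℂ))).mp halg

/-- The base of the Nesterenko cells lies in `𝓛`: `e^{iπ} = -1`. -/
theorem pi_mul_I_mem_logs :
    (Real.pi : ℂ) * I ∈ Submodule.span ℚ {z : ℂ | IsAlgebraic ℚ (Complex.exp z)} := by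
  refine Submodule.subset_span ?_
  change IsAlgebraic ℚ (Complex.exp ((Real.pi : ℂ) * I))
  rw [Complex.exp_pi_mul_I]
  exact isAlgebraic_one.neg

/-- `iπ = 1·(iπ)` is a Baker period. -/
theorem pi_mul_I_mem_bakerPeriods : (Real.pi : ℂ) * I ∈ Submodule.span ℚ
      {z : ℂ | ∃ β l : ℂ, IsAlgebraic ℚ β ∧ IsAlgebraic ℚ (Complex.exp l) ∧ z = β * l} := by
  refine Submodule.subset_span ⟨1, (Real.pi : ℂ) * I, isAlgebraic_one, ?_, (one_mul _).symm⟩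
  rw [Complex.exp_pi_mul_I]; exact isAlgebraic_one.neg

/-- `π = (-I)·(iπ)` is a Baker period. -/
theorem pi_mem_bakerPeriods : (Real.pi : ℂ) ∈ Submodule.span ℚ
      {z : ℂ | ∃ β l : ℂ, IsAlgebraic ℚ β ∧ IsAlgebraic ℚ (Complex.exp l) ∧ z = β * l} := by
  refine Submodule.subset_span ⟨-I, (Real.pi : ℂ) * I, isAlgebraic_I.neg, ?_, ?_⟩
  · rw [Complex.exp_pi_mul_I]; exact isAlgebraic_one.neg
  · rw [mul_comm (Real.pi : ℂ) I, ← mul_assoc, neg_mul, Complex.I_mul_I, neg_neg, one_mul]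

/-- `π` is free modulo `𝓛` (else `e^{qπ} ∈ ℚ̄` for some `q ≠ 0`, contradicting Nesterenko). -/
theorem pi_free_mod_logs (hN : nesterenko) :
    LinearIndependent ℚ
      ((Submodule.span ℚ {z : ℂ | IsAlgebraic ℚ (Complex.exp z)}).mkQ ∘ ![(Real.pi : ℂ)]) := by
  rw [linearIndependent_unique_iff]
  intro h0
  have hmem : (Real.pi : ℂ) ∈ Submodule.span ℚ {z : ℂ | IsAlgebraic ℚ (Complex.exp z)} := by
    have h := (Submodule.Quotient.mk_eq_zero _).mp h0
    simpa using h
  exact transcendental_exp_pi hN (isAlgebraic_exp_of_mem_span hmem)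

/-- `(iπ, π)` is `ℚ`-linearly independent (else `π² ∈ ℚ·i ⊂ ℚ̄`, but `π` is transcendental). -/
theorem linearIndependent_ipi_pi (hN : nesterenko) :
    LinearIndependent ℚ ![(Real.pi : ℂ) * I, (Real.pi : ℂ)] := by
  have h2 := algebraicIndependent_pi_exp_pi hN
  have hπ : Transcendental ℚ (Real.pi : ℂ) := by
    have h := h2.transcendental 0
    simpa using h
  refine LinearIndependent.pair_iff.mpr fun s t hst => ?_
  have hπ0 : (Real.pi : ℂ) ≠ 0 := by exact_mod_cast Real.pi_ne_zero
  have hst' : ((s : ℂ) * I + (t : ℂ)) * (Real.pi : ℂ) = 0 := by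
    have e : s • ((Real.pi : ℂ) * I) + t • (Real.pi : ℂ) = ((s : ℂ) * I + (t : ℂ)) * (Real.pi : ℂ) := by
      rw [Rat.smul_def, Rat.smul_def]; ring
    rw [← e]; exact hst
  have hc : (s : ℂ) * I + (t : ℂ) = 0 := (mul_eq_zero.mp hst').resolve_right hπ0
  have hs : s = 0 := by
    have him := congrArg Complex.im hc
    simpa using him
  have ht : t = 0 := by
    have hre := congrArg Complex.re hc
    simpa [hs] using hre
  exact ⟨hs, ht⟩

/-- CELL (A = `SchanuelAtBakerPeriods`, stmt-Schanuel-24885, rank 2, at the Baker periods `(iπ, π)`;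
Nesterenko): `trdeg ℚ(iπ, π, e^{iπ}, e^π) ≥ 2`. Schanuel predicts exactly `2` here; OPEN one rank up
(`(iπ, π, log 2)`). Hypotheses certified by `pi_mul_I_mem_bakerPeriods`, `pi_mem_bakerPeriods`,
`linearIndependent_ipi_pi`. -/
theorem schanuelAtBakerPeriods_cell_ipi_pi (hN : nesterenko) :
    ((2 : ℕ) : Cardinal) ≤ Algebra.trdeg ℚ ↥(adjoin ℚ (Set.range ![(Real.pi : ℂ) * I, (Real.pi : ℂ)] ∪
      Set.range (cexp ∘ ![(Real.pi : ℂ) * I, (Real.pi : ℂ)]))) := by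
  set F := adjoin ℚ (Set.range ![(Real.pi : ℂ) * I, (Real.pi : ℂ)] ∪
      Set.range (cexp ∘ ![(Real.pi : ℂ) * I, (Real.pi : ℂ)])) with hF
  have hpi : (Real.pi : ℂ) ∈ F := subset_adjoin ℚ _ (Or.inl ⟨1, rfl⟩)
  have hepi : cexp (Real.pi : ℂ) ∈ F := subset_adjoin ℚ _ (Or.inr ⟨1, rfl⟩)
  let x : Fin 2 → F := ![⟨(Real.pi : ℂ), hpi⟩, ⟨cexp (Real.pi : ℂ), hepi⟩]
  have hx : AlgebraicIndependent ℚ x := by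
    refine AlgebraicIndependent.of_comp F.val ?_
    convert algebraicIndependent_pi_exp_pi hN using 1
    funext i
    fin_cases i <;> rfl
  simpa using hx.cardinalMk_le_trdeg

/-- CELL (the 1D child `BakerPeriodsOverLogFields` = `Rel(𝓑|𝓛)`, stmt-Schanuel-26558, over a NONEMPTY
TRANSCENDENTAL BASE; Nesterenko): the instance `(u; w) = ((iπ); (π))` —
`trdeg_{ℚ(iπ)} ℚ(iπ)(π, e^π) ≥ 1`, i.e. `e^π ∉ acl ℚ(π)`. Its hypotheses are certified by
`pi_mul_I_mem_logs`, `pi_mem_bakerPeriods`, `pi_free_mod_logs`. -/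
theorem bakerPeriodsOverLogFields_cell_pi (hN : nesterenko) :
    ((1 : ℕ) : Cardinal) ≤ Algebra.trdeg
      ↥(adjoin ℚ (Set.range ![(Real.pi : ℂ) * I] ∪ Set.range (cexp ∘ ![(Real.pi : ℂ) * I])))
      ↥(adjoin ↥(adjoin ℚ (Set.range ![(Real.pi : ℂ) * I] ∪ Set.range (cexp ∘ ![(Real.pi : ℂ) * I])))
        (Set.range ![(Real.pi : ℂ)] ∪ Set.range (cexp ∘ ![(Real.pi : ℂ)]))) := by
  have hfin := trdeg_gens_lt_aleph0 ![(Real.pi : ℂ) * I]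
  refine (rel_iff_add _ _ hfin 1).2 ?_
  -- the base has transcendence degree ≤ 1 (`e^{iπ} = -1` is algebraic)
  have hbase : Algebra.trdeg ℚ
      ↥(adjoin ℚ (Set.range ![(Real.pi : ℂ) * I] ∪ Set.range (cexp ∘ ![(Real.pi : ℂ) * I]))) ≤ 1 := by
    have halg : ∀ a ∈ Set.range (cexp ∘ ![(Real.pi : ℂ) * I]), IsAlgebraic ℚ a := by
      rintro _ ⟨i, rfl⟩
      have hi : i = 0 := Subsingleton.elim _ _
      subst hi
      change IsAlgebraic ℚ (cexp ((Real.pi : ℂ) * I))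
      rw [Complex.exp_pi_mul_I]
      exact isAlgebraic_one.neg
    calc Algebra.trdeg ℚ
          ↥(adjoin ℚ (Set.range ![(Real.pi : ℂ) * I] ∪ Set.range (cexp ∘ ![(Real.pi : ℂ) * I])))
        = Algebra.trdeg ℚ ↥(adjoin ℚ (Set.range ![(Real.pi : ℂ) * I])) :=
          Literature.Barriers.Schanuel.trdeg_adjoin_union_eq_of_isAlgebraic _ _ halg
      _ ≤ Cardinal.mk (Set.range ![(Real.pi : ℂ) * I]) := trdeg_adjoin_le_cardinalMk _
      _ ≤ 1 := by simp
  -- the top field contains `π, e^π`, algebraically independent by Nesterenko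
  set F := adjoin ℚ ((Set.range ![(Real.pi : ℂ) * I] ∪ Set.range (cexp ∘ ![(Real.pi : ℂ) * I])) ∪
    (Set.range ![(Real.pi : ℂ)] ∪ Set.range (cexp ∘ ![(Real.pi : ℂ)]))) with hF
  have hpi : (Real.pi : ℂ) ∈ F := subset_adjoin ℚ _ (Or.inr (Or.inl ⟨0, rfl⟩))
  have hepi : cexp (Real.pi : ℂ) ∈ F := subset_adjoin ℚ _ (Or.inr (Or.inr ⟨0, rfl⟩))
  let x : Fin 2 → F := ![⟨(Real.pi : ℂ), hpi⟩, ⟨cexp (Real.pi : ℂ), hepi⟩]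
  have hx : AlgebraicIndependent ℚ x := by
    refine AlgebraicIndependent.of_comp F.val ?_
    convert algebraicIndependent_pi_exp_pi hN using 1
    funext i
    fin_cases i <;> rfl
  have hF2 : (2 : Cardinal) ≤ Algebra.trdeg ℚ F := by simpa using hx.cardinalMk_le_trdeg
  calc Algebra.trdeg ℚ ↥(adjoin ℚ (Set.range ![(Real.pi : ℂ) * I] ∪
          Set.range (cexp ∘ ![(Real.pi : ℂ) * I]))) + ((1 : ℕ) : Cardinal)
        ≤ 1 + 1 := add_le_add hbase (by simp)
    _ = 2 := by norm_num
    _ ≤ Algebra.trdeg ℚ F := hF2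

end Summit.Schanuel.Schanuel.Theorems.RootDecomp1JFlagCells

end
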